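import Literature.Analysis.Calculus.BorderedImplicitFunction
import Literature.Analysis.Calculus.ProductImplicitFunction

/-!
# Persistence of a simply degenerate zero along an intrinsic unfolding direction (bordered implicit
# function theorem with a state-dependent border; Chow–Hale 1982 §2.4, Kielhöfer 2012 §I.2)

Analysis/Calculus proof file (Mathlib only; theorems only, no definitions, no named facts).
Companion of `Literature.Analysis.Calculus.BorderedImplicitFunction` and
`Literature.Analysis.Calculus.BorderedImplicitFamily`: there the border of the bordered system is a
FIXED vector (`frc d`, resp. an external `e ∉ range T`).  Here the border is STATE-DEPENDENT: given a
zero `u₀` of `G u = frc c` whose linearisation `T = DG(u₀)` is a compact perturbation of a linear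
homeomorphism with `ker T ⊆ ℝ·g`, and a bounded linear map `A : X → Y` (an "intrinsic unfolding
direction": on the applications side the generator of a one-parameter group acting on the state,
e.g. a Galilean drift or a change of viscosity) which is VISIBLE AT FIRST ORDER, `A u₀ ∉ range T`, the
perturbed equation `G u + t·A u = frc c'` is solved for `(u, t)` near `(u₀, 0)` for every `c'` near
`c`.  The proof is the Lyapunov–Schmidt bordering of Chow–Hale 1982 §2.4 / Kielhöfer 2012 §I.2: a
Hahn–Banach functional `φ` with `φ g ≠ 0` borders `T` into the bijection
`(w, s) ↦ (T w + s·A u₀, φ w)` of `X × ℝ` onto `Y × ℝ` (the bordering lemma `bordered_bijective` with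
border vector `−A u₀`), which is exactly the partial derivative in `(u, t)` at `((u₀, 0), c)` of
`f ((u, t), c') = (G u + t·A u − frc c', φ (u − u₀))`; the implicit function theorem in block form
(`exists_implicit_of_block_deriv`) then produces the `C¹` germ `c' ↦ (u, t)`.

* `bordered_unfolding_implicit` — the implicit-function step: for `G` of class `C¹` at `u₀` with
  derivative `T`, `G u₀ = frc c` and `(w, s) ↦ (T w + s·A u₀, φ w)` bijective, a `C¹` germ
  `ψ : P → X × ℝ` at `c` with `ψ c = (u₀, 0)` solving `G u + t·A u = frc c'`, `φ (u − u₀) = 0` for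
  `(u, t) = ψ c'`, `c'` near `c`, uniquely near `((u₀, 0), c)`.
* `bordered_unfolding_persistence` — the persistence statement: compact perturbation of a linear
  homeomorphism, `ker T ⊆ ℝ·g`, `A u₀ ∉ range T` ⇒ for every `δ > 0` all `c'` in a ball around `c`
  admit `(u, t)` with `dist u u₀ < δ`, `|t| < δ`, `G u + t·A u = frc c'`.

Not here: the group-orbit analysis identifying `t` (summit side), higher kernel dimension,
parameter-dependent `G`, smoothness of the solution germ beyond `C¹`.

## References

* S.-N. Chow, J. K. Hale, *Methods of Bifurcation Theory*, Grundlehren 251, Springer (1982), §2.4,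
  Ch. 6. [ChowHale1982]
* H. Kielhöfer, *Bifurcation Theory. An Introduction with Applications to Partial Differential
  Equations*, 2nd ed., Applied Mathematical Sciences 156, Springer (2012), §I.2 (the
  Lyapunov–Schmidt reduction). [Kielhofer2012]
-/

noncomputable section

open scoped Topology
open Filter Set Function

namespace Literature.Analysis.Calculus

section Unfolding

variable {X Y P : Type*} [NormedAddCommGroup X] [NormedSpace ℝ X] [CompleteSpace X]
  [NormedAddCommGroup Y] [NormedSpace ℝ Y] [CompleteSpace Y]
  [NormedAddCommGroup P] [NormedSpace ℝ P] [CompleteSpace P]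

/-- **The bordered implicit function theorem with a state-dependent border** (Chow–Hale 1982 §2.4,
Kielhöfer 2012 §I.2).  Let `G : X → Y` be `C¹` at `u₀` with derivative `T`, `G u₀ = frc c` for a
continuous linear `frc : P → Y`, let `A : X → Y` be continuous linear and `φ` a functional such that
the bordered operator `(w, s) ↦ (T w + s·A u₀, φ w)` is bijective `X × ℝ → Y × ℝ`.  Then there is a
germ `ψ : P → X × ℝ`, `C¹` at `c`, with `ψ c = (u₀, 0)`, solving `G u + t·A u = frc c'`,
`φ (u − u₀) = 0` for `(u, t) = ψ c'` and all `c'` near `c`, and every solution `((u, t), c')` of these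
two equations near `((u₀, 0), c)` lies on its graph. [folklore] -/
theorem bordered_unfolding_implicit (G : X → Y) (A : X →L[ℝ] Y) (frc : P →L[ℝ] Y) (T : X →L[ℝ] Y)
    (φ : X →L[ℝ] ℝ) (u₀ : X) (c : P) (hG : ContDiffAt ℝ 1 G u₀) (hT : HasFDerivAt G T u₀)
    (h0 : G u₀ = frc c) (hD : Bijective fun p : X × ℝ => (T p.1 + p.2 • A u₀, φ p.1)) :
    ∃ ψ : P → X × ℝ, ψ c = (u₀, 0) ∧ ContDiffAt ℝ 1 ψ c ∧
      (∀ᶠ c' in 𝓝 c, G (ψ c').1 + (ψ c').2 • A (ψ c').1 = frc c' ∧ φ ((ψ c').1 - u₀) = 0) ∧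
      ∀ᶠ q in 𝓝 (((u₀, 0), c) : (X × ℝ) × P),
        G q.1.1 + q.1.2 • A q.1.1 = frc q.2 → φ (q.1.1 - u₀) = 0 → q.1 = ψ q.2 := by
  -- the map `f ((u, t), c') = (G u + t • A u − frc c', φ (u − u₀))` and its base point
  set f : (X × ℝ) × P → Y × ℝ :=
    fun q => (G q.1.1 + q.1.2 • A q.1.1 - frc q.2, φ (q.1.1 - u₀)) with hf
  set pt : (X × ℝ) × P := ((u₀, 0), c) with hpt
  have hfpt : f pt = 0 := by simp [hf, hpt, h0]
  -- projections
  set πp : (X × ℝ) × P →L[ℝ] X × ℝ := ContinuousLinearMap.fst ℝ (X × ℝ) P with hπp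
  set πc : (X × ℝ) × P →L[ℝ] P := ContinuousLinearMap.snd ℝ (X × ℝ) P with hπc
  set πu : (X × ℝ) × P →L[ℝ] X := (ContinuousLinearMap.fst ℝ X ℝ).comp πp with hπu
  set πt : (X × ℝ) × P →L[ℝ] ℝ := (ContinuousLinearMap.snd ℝ X ℝ).comp πp with hπt
  have hπupt : πu pt = u₀ := rfl
  have hπtpt : πt pt = 0 := rfl
  -- the bordered operator `M (w, s) = (T w + s • A u₀, φ w)` is a linear homeomorphism (Banach)
  set M : X × ℝ →L[ℝ] Y × ℝ :=
    (T.comp (ContinuousLinearMap.fst ℝ X ℝ) +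
        (ContinuousLinearMap.snd ℝ X ℝ).smulRight (A u₀)).prod
      (φ.comp (ContinuousLinearMap.fst ℝ X ℝ)) with hM
  have hMfun : ⇑M = fun p : X × ℝ => (T p.1 + p.2 • A u₀, φ p.1) := by
    funext p
    simp [hM]
  have hMb : Bijective M := by
    rw [hMfun]
    exact hD
  set fx : (X × ℝ) ≃L[ℝ] (Y × ℝ) := ContinuousLinearEquiv.ofBijective M
    (LinearMap.ker_eq_bot.2 hMb.1) (LinearMap.range_eq_top.2 hMb.2) with hfx
  have hfxM : (fx : X × ℝ →L[ℝ] Y × ℝ) = M := ContinuousLinearEquiv.coe_ofBijective _ _ _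
  set fy : P →L[ℝ] Y × ℝ := (-frc).prod (0 : P →L[ℝ] ℝ) with hfy
  -- the derivative of `f` at `pt` in block form `fx ∘ fst + fy ∘ snd`
  have e4 : (fun q : (X × ℝ) × P => φ (q.1.1 - u₀)) = fun q => (φ.comp πu) q - φ u₀ := by
    funext q
    simp [hπu, hπp, map_sub]
  have hd : HasFDerivAt f ((fx : X × ℝ →L[ℝ] Y × ℝ).comp (ContinuousLinearMap.fst ℝ (X × ℝ) P) +
      fy.comp (ContinuousLinearMap.snd ℝ (X × ℝ) P)) pt := by
    have h1 : HasFDerivAt (fun q : (X × ℝ) × P => G q.1.1) (T.comp πu) pt := by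
      have hT' : HasFDerivAt G T (πu pt) := by rw [hπupt]; exact hT
      exact hT'.comp pt πu.hasFDerivAt
    have h2 : HasFDerivAt (fun q : (X × ℝ) × P => q.1.2 • A q.1.1) (πt.smulRight (A u₀)) pt := by
      have h := (πt.hasFDerivAt (x := pt)).smul ((A.comp πu).hasFDerivAt (x := pt))
      rw [hπtpt, zero_smul, zero_add] at h
      exact h
    have h3 : HasFDerivAt (fun q : (X × ℝ) × P => frc q.2) (frc.comp πc) pt :=
      (frc.comp πc).hasFDerivAt
    have h4 : HasFDerivAt (fun q : (X × ℝ) × P => φ (q.1.1 - u₀)) (φ.comp πu) pt := by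
      rw [e4]; exact (φ.comp πu).hasFDerivAt.sub_const (φ u₀)
    refine (((h1.add h2).sub h3).prodMk h4).congr_fderiv ?_
    rw [hfxM]
    refine ContinuousLinearMap.ext fun q => ?_
    obtain ⟨⟨w, s⟩, d⟩ := q
    simp [hM, hfy, hπu, hπt, hπc, hπp, sub_eq_add_neg]
  -- `f` is `C¹` at `pt`
  have hfc : ContDiffAt ℝ 1 f pt := by
    have h1 : ContDiffAt ℝ 1 (fun q : (X × ℝ) × P => G q.1.1) pt := by
      have hG' : ContDiffAt ℝ 1 G (πu pt) := by rw [hπupt]; exact hG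
      exact hG'.comp pt πu.contDiff.contDiffAt
    have h2 : ContDiffAt ℝ 1 (fun q : (X × ℝ) × P => q.1.2 • A q.1.1) pt :=
      (πt.contDiff.contDiffAt (x := pt)).smul ((A.comp πu).contDiff.contDiffAt (x := pt))
    have h3 : ContDiffAt ℝ 1 (fun q : (X × ℝ) × P => frc q.2) pt :=
      (frc.comp πc).contDiff.contDiffAt
    have h4 : ContDiffAt ℝ 1 (fun q : (X × ℝ) × P => φ (q.1.1 - u₀)) pt := by
      rw [e4]; exact (φ.comp πu).contDiff.contDiffAt.sub contDiffAt_const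
    exact ((h1.add h2).sub h3).prodMk h4
  -- the implicit function theorem in block form
  obtain ⟨ψ, hψc, hψd, hev, huniq, -⟩ :=
    exists_implicit_of_block_deriv (𝕜 := ℝ) (n := 1) hfc le_rfl fx fy hd
  rw [hfpt] at hev huniq
  refine ⟨ψ, hψc, hψd, ?_, ?_⟩
  · have hev' : ∀ᶠ c' in 𝓝 c, f (ψ c', c') = 0 := hev
    filter_upwards [hev'] with c' hc'
    simp only [hf, Prod.mk_eq_zero, sub_eq_zero] at hc'
    exact hc'
  · have huniq' : ∀ᶠ q in 𝓝 (((u₀, 0), c) : (X × ℝ) × P), f q = 0 → q.1 = ψ q.2 := huniq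
    filter_upwards [huniq'] with q hq hGq hφq
    refine hq ?_
    simp only [hf, Prod.mk_eq_zero]
    exact ⟨sub_eq_zero.2 hGq, hφq⟩

/-- **Persistence of a simply degenerate zero along an intrinsic unfolding direction** (Chow–Hale
1982 §2.4, Kielhöfer 2012 §I.2).  Let `G : X → Y` be `C¹` at `u₀` with derivative `T`, `G u₀ = frc c`
for a continuous linear `frc : P → Y`, let `T` be a compact perturbation of a linear homeomorphism
`J : X ≃ Y` with `ker T ⊆ ℝ·g`, and let the continuous linear `A : X → Y` be visible at first order,
`A u₀ ∉ range T`.  Then for every `δ > 0` there is `ρ > 0` such that for every `c'` with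
`dist c' c < ρ` the perturbed equation `G u + t·A u = frc c'` has a solution `(u, t)` with
`dist u u₀ < δ` and `|t| < δ`.  (Hahn–Banach functional `φ` with `φ g ≠ 0`, the bordering lemma
`bordered_bijective` with border vector `−A u₀`, and `bordered_unfolding_implicit`.) [folklore] -/
theorem bordered_unfolding_persistence
    (G : X → Y) (A : X →L[ℝ] Y) (frc : P →L[ℝ] Y) (T : X →L[ℝ] Y) (J : X ≃L[ℝ] Y) (u₀ g : X) (c : P)
    (hG : ContDiffAt ℝ 1 G u₀) (hT : HasFDerivAt G T u₀) (h0 : G u₀ = frc c)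
    (hK : IsCompactOperator (T - (J : X →L[ℝ] Y) : X →L[ℝ] Y))
    (hker : ∀ x, T x = 0 → ∃ z : ℝ, x = z • g) (hrange : ∀ x, T x ≠ A u₀) :
    ∀ δ : ℝ, 0 < δ → ∃ ρ : ℝ, 0 < ρ ∧ ∀ c' : P, dist c' c < ρ →
      ∃ (u : X) (t : ℝ), dist u u₀ < δ ∧ |t| < δ ∧ G u + t • A u = frc c' := by
  -- `g ≠ 0`: otherwise `T` is injective, hence bijective, contradicting `A u₀ ∉ range T`
  have hg : g ≠ 0 := by
    intro hg
    have hinj : Injective T := by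
      rw [injective_iff_map_eq_zero]
      intro x hx
      obtain ⟨z, rfl⟩ := hker x hx
      rw [hg, smul_zero]
    obtain ⟨x, hx⟩ := (bijective_of_injective_of_isCompactOperator T J hK hinj).2 (A u₀)
    exact hrange x hx
  -- Hahn–Banach: a functional which does not kill the kernel vector
  have hgn : ‖g‖ ≠ 0 := norm_ne_zero_iff.2 hg
  obtain ⟨φ, -, hφg⟩ := exists_dual_vector ℝ g hgn
  have hφ : φ g ≠ 0 := by
    rw [hφg]
    exact_mod_cast hgn
  -- the bordering lemma with border vector `-(A u₀)`
  have hrange' : ∀ x, T x ≠ -A u₀ := fun x hx => hrange (-x) (by rw [map_neg, hx, neg_neg])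
  have hD : Bijective fun p : X × ℝ => (T p.1 + p.2 • A u₀, φ p.1) := by
    have h := bordered_bijective T J hK g (-A u₀) φ hker hrange' hφ
    have hfun : (fun p : X × ℝ => (T p.1 - p.2 • -A u₀, φ p.1)) =
        fun p : X × ℝ => (T p.1 + p.2 • A u₀, φ p.1) := by
      funext p
      rw [smul_neg, sub_neg_eq_add]
    rw [hfun] at h
    exact h
  -- the implicit germ `ψ = (u, t)` and its continuity at `c`
  obtain ⟨ψ, hψc, hψd, hev, -⟩ := bordered_unfolding_implicit G A frc T φ u₀ c hG hT h0 hD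
  intro δ hδ
  have hnear : ∀ᶠ c' in 𝓝 c, dist (ψ c') (ψ c) < δ :=
    Metric.tendsto_nhds.1 hψd.continuousAt δ hδ
  obtain ⟨ρ, hρ, hball⟩ := Metric.eventually_nhds_iff.1 (hev.and hnear)
  refine ⟨ρ, hρ, fun c' hc' => ?_⟩
  obtain ⟨⟨hsol, -⟩, hdist⟩ := hball hc'
  rw [hψc, Prod.dist_eq, max_lt_iff] at hdist
  have ht : dist (ψ c').2 0 < δ := hdist.2
  rw [Real.dist_0_eq_abs] at ht
  exact ⟨(ψ c').1, (ψ c').2, hdist.1, ht, hsol⟩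

end Unfolding

end Literature.Analysis.Calculus

end
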